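import Literature.NumberTheory.Sieve.ParityWave0LogChowlaOddGvN
import Mathlib.NumberTheory.ArithmeticFunction.Liouville
import Mathlib.NumberTheory.Harmonic.Bounds
import HarnessLib

/-!
# Odd-order logarithmic Chowla (Tao–Teräväinen 2018): the comparison theorem (Theorem 3.2)

Topic `Literature/NumberTheory/Sieve`.  Everything in this file is PROVED relative to the named fact
`Literature.NumberTheory.Sieve.GreenTao2010_gowersUniformityAt s` (explicit hypothesis); no new named facts.
Definitions are bookkeeping only (the objects of §3 of the paper).

Second step of the tree's formalisation of T. Tao, J. Teräväinen, *Odd order cases of the logarithmically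
averaged Chowla conjecture*, J. Théor. Nombres Bordeaux **30** (2018), 997–1015 (arXiv:1710.02112), towards
`Literature.NumberTheory.Sieve.liouville_logCorrelation_isLittleO_of_odd` (`ParityWave0.lean`, parity.S22), after
`ParityWave0LogChowlaOddGvN.lean` (the bilinear estimate of Lemma 5.2 + Lemma 5.3).  Here: the objects of §3 —
`f_x(a) = 𝔼^{log}_{n ≤ x} λ(n + a c₀) ⋯ λ(n + a c_s)` (`corrAvg`), the logarithmic prime averages
`𝔼^{log}_{2^m < p ≤ 2^{m+1}}` (`primeLogAvg`) and the logarithmic averages over integers coprime to `W` in a dyadic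
block (`roughLogAvg`) — and **Theorem 3.2 (Comparison)**, proved as in §5 of the paper from the bilinear estimate:
`𝔼^{log}_{2^m < p ≤ 2^{m+1}} f_x(ap) = 𝔼^{log}_{2^m < n ≤ 2^{m+1}, (n,W)=1} f_x(an) + O(ε)`.

Rendering / bookkeeping choices (all forced by writing the printed argument out):
* `Λ` is replaced by `Λ'` (supported on primes), so the "prime powers are negligible" step disappears; the
  printed weight `W/φ(W) Λ(d) - 1` is `φ(W)/W Λ(d) - 1` (a typo in the paper; the next display there,
  with `Λ_{b,W}`, is the correct one and is what we use).
* The passage from the logarithmic weights to the flat sums of the bilinear estimate is done by Abel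
  summation in `d` FIRST, and the shift-averaging in `n` (with `N' = aWh`, splitting `n' = aW n'' + r`)
  afterwards, so that only square ranges `[1,h]²` are needed; the shift of a logarithmic average by `j`
  costs `≤ 3j / ∑_{n ≤ x} 1/n` (crude but sufficient since `x` is chosen last).
* Quantifier shape of `comparison`: `∃ w₀ ∀ w ≥ w₀ ∀ A ∃ M₀ ∀ M₄ ∃ X₀ ∀ x ≥ X₀ ∀ m ∈ [M₀, M₄] ∀ a ∈ [1, A]` —
  the paper's "`a ≤ H₊`" is only ever used with `a ≤ H₂ < H₃ ≤ 2^m` (§3), which is this shape.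

## References

* T. Tao, J. Teräväinen, J. Théor. Nombres Bordeaux 30 (2018), 997–1015, doi:10.5802/jtnb.1062 = arXiv:1710.02112:
  §2 (notation `𝔼^{log}`), §3 ((fax), Theorem 3.2), §5 (proof of Theorem 3.2). [TaoTeravainenJTNB2018]
* B. Green, T. Tao, *Linear equations in primes*, Ann. of Math. 171 (2010): Thm. 7.2 (the hypothesis). [GreenTao2010]
-/

noncomputable section

open Finset
open scoped BigOperators

namespace Literature.NumberTheory.Sieve

namespace TaoTeravainen2018

/-! ### The objects of §3 -/

/-- The Liouville function as a real-valued function on `ℕ` (`λ(0) = 0`). [folklore] -/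
def lam (n : ℕ) : ℝ := (ArithmeticFunction.liouville n : ℝ)

/-- `|λ(n)| ≤ 1`. [folklore] -/
theorem abs_lam_le_one (n : ℕ) : |lam n| ≤ 1 := by
  unfold lam
  by_cases hn : n = 0
  · subst hn; simp
  · rw [ArithmeticFunction.liouville_apply hn]
    rcases neg_one_pow_eq_or ℤ (ArithmeticFunction.cardFactors n) with h | h <;> rw [h] <;> simp

/-- The sign product `λ(n + r c₀) ⋯ λ(n + r c_s)` (the integrand of (fax) with `aⱼ = 1`, `bⱼ = cⱼ`, at `a = r`).
[cite: TaoTeravainenJTNB2018, (fax)] -/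
def signProd {s : ℕ} (c : Fin (s + 1) → ℕ) (r n : ℕ) : ℝ := ∏ j, lam (n + r * c j)

/-- `|∏ λ| ≤ 1`. [folklore] -/
theorem abs_signProd_le_one {s : ℕ} (c : Fin (s + 1) → ℕ) (r n : ℕ) : |signProd c r n| ≤ 1 := by
  unfold signProd
  rw [Finset.abs_prod]
  exact Finset.prod_le_one (fun _ _ => abs_nonneg _) fun j _ => abs_lam_le_one _

/-- `L_x = ∑_{n ≤ x} 1/n`, the normalisation of logarithmic averages. [cite: TaoTeravainenJTNB2018, §2] -/
def harm (x : ℕ) : ℝ := ∑ n ∈ Icc 1 x, (1 : ℝ) / n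

/-- `L_x ≥ log x` (`≥ log (x+1)`, Mathlib `log_add_one_le_harmonic`). [folklore] -/
theorem log_le_harm (x : ℕ) : Real.log x ≤ harm x := by
  have h := log_add_one_le_harmonic x
  rw [harmonic_eq_sum_Icc] at h
  push_cast at h
  have h2 : Real.log x ≤ Real.log ((x : ℝ) + 1) := by
    rcases Nat.eq_zero_or_pos x with hx | hx
    · subst hx; simp
    · exact Real.log_le_log (by exact_mod_cast hx) (by linarith)
  unfold harm
  simp only [one_div]
  linarith

/-- `L_x ≥ 1` for `x ≥ 1`. [folklore] -/
theorem one_le_harm {x : ℕ} (hx : 1 ≤ x) : 1 ≤ harm x := by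
  unfold harm
  have h1 : ∑ n ∈ Icc (1 : ℕ) 1, (1 : ℝ) / (n : ℝ) = 1 := by simp
  calc (1 : ℝ) = ∑ n ∈ Icc (1 : ℕ) 1, (1 : ℝ) / (n : ℝ) := h1.symm
    _ ≤ ∑ n ∈ Icc 1 x, (1 : ℝ) / (n : ℝ) :=
        Finset.sum_le_sum_of_subset_of_nonneg (Finset.Icc_subset_Icc_right hx) fun _ _ _ => by positivity

/-- `L_x > 0` for `x ≥ 1`. [folklore] -/
theorem harm_pos {x : ℕ} (hx : 1 ≤ x) : 0 < harm x := lt_of_lt_of_le one_pos (one_le_harm hx)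

/-- `f_x(r) = 𝔼^{log}_{n ≤ x} λ(n + r c₀) ⋯ λ(n + r c_s)` ((fax) with `aⱼ = 1`, `bⱼ = cⱼ`, at `a = r`).
[cite: TaoTeravainenJTNB2018, (fax)] -/
def corrAvg {s : ℕ} (c : Fin (s + 1) → ℕ) (x r : ℕ) : ℝ := (∑ n ∈ Icc 1 x, signProd c r n / n) / harm x

/-- `|∑_{n ≤ x} F(n)/n| ≤ L_x` for `1`-bounded `F`. [folklore] -/
theorem abs_sum_div_le_harm {F : ℕ → ℝ} (hF : ∀ n, |F n| ≤ 1) (x : ℕ) :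
    |∑ n ∈ Icc 1 x, F n / n| ≤ harm x := by
  unfold harm
  calc |∑ n ∈ Icc 1 x, F n / n| ≤ ∑ n ∈ Icc 1 x, |F n / n| := Finset.abs_sum_le_sum_abs _ _
    _ ≤ ∑ n ∈ Icc 1 x, (1 : ℝ) / n := Finset.sum_le_sum fun n _ => by
        rw [abs_div, Nat.abs_cast]
        exact div_le_div_of_nonneg_right (hF n) (by positivity)

/-- `|f_x(r)| ≤ 1`. [folklore] -/
theorem abs_corrAvg_le_one {s : ℕ} (c : Fin (s + 1) → ℕ) (x r : ℕ) : |corrAvg c x r| ≤ 1 := by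
  unfold corrAvg
  rcases Nat.eq_zero_or_pos x with hx | hx
  · subst hx; simp [harm]
  · rw [abs_div, abs_of_pos (harm_pos hx), div_le_one (harm_pos hx)]
    exact abs_sum_div_le_harm (fun n => abs_signProd_le_one c r n) x

/-- The primes of the dyadic block `(2^m, 2^{m+1}]`. [cite: TaoTeravainenJTNB2018, Theorem 3.1] -/
def primeBlock (m : ℕ) : Finset ℕ := (Ioc (2 ^ m) (2 ^ (m + 1))).filter Nat.Prime

/-- The integers of the dyadic block `(2^m, 2^{m+1}]` coprime to `W`. [cite: TaoTeravainenJTNB2018, Theorem 3.2] -/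
def roughBlock (W m : ℕ) : Finset ℕ := (Ioc (2 ^ m) (2 ^ (m + 1))).filter fun n => Nat.Coprime W n

/-- `𝔼^{log}_{2^m < p ≤ 2^{m+1}} G(p)`. [cite: TaoTeravainenJTNB2018, §2] -/
def primeLogAvg (m : ℕ) (G : ℕ → ℝ) : ℝ :=
  (∑ p ∈ primeBlock m, G p / p) / ∑ p ∈ primeBlock m, (1 : ℝ) / p

/-- `𝔼^{log}_{2^m < n ≤ 2^{m+1}, (n,W)=1} G(n)`. [cite: TaoTeravainenJTNB2018, Theorem 3.2] -/
def roughLogAvg (W m : ℕ) (G : ℕ → ℝ) : ℝ :=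
  (∑ n ∈ roughBlock W m, G n / n) / ∑ n ∈ roughBlock W m, (1 : ℝ) / n

/-- Membership in the prime block. [folklore] -/
theorem mem_primeBlock {m p : ℕ} : p ∈ primeBlock m ↔ (2 ^ m < p ∧ p ≤ 2 ^ (m + 1)) ∧ p.Prime := by
  simp [primeBlock]

/-- Membership in the rough block. [folklore] -/
theorem mem_roughBlock {W m n : ℕ} : n ∈ roughBlock W m ↔ (2 ^ m < n ∧ n ≤ 2 ^ (m + 1)) ∧ Nat.Coprime W n := by
  simp [roughBlock]

/-- The prime block is non-empty (Bertrand's postulate). [folklore] -/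
theorem primeBlock_nonempty (m : ℕ) : (primeBlock m).Nonempty := by
  obtain ⟨p, hp, hlt, hle⟩ := Nat.exists_prime_lt_and_le_two_mul (2 ^ m) (by positivity)
  exact ⟨p, mem_primeBlock.mpr ⟨⟨hlt, by rw [pow_succ]; linarith⟩, hp⟩⟩

/-! ### Shifting a logarithmic average (§4, "total variation bound", in crude form) -/

/-- Telescoping: `∑_{n=1}^{x} (1/n - 1/(n+1)) = 1 - 1/(x+1)`. [folklore] -/
theorem sum_inv_sub_inv_succ (x : ℕ) :
    ∑ n ∈ Icc 1 x, ((1 : ℝ) / n - 1 / (n + 1)) = 1 - 1 / (x + 1) := by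
  induction x with
  | zero => simp
  | succ x ih =>
    rw [Finset.sum_Icc_succ_top (by omega), ih]
    push_cast
    ring

/-- The unit shift identity for logarithmic sums. [folklore] -/
theorem sum_shift_one_sub_eq (F : ℕ → ℝ) (x : ℕ) :
    ∑ n ∈ Icc 1 x, F (n + 1) / n - ∑ n ∈ Icc 1 x, F n / n =
      ∑ n ∈ Icc 1 x, F (n + 1) * (1 / n - 1 / (n + 1)) + F (x + 1) / (x + 1) - F 1 := by
  induction x with
  | zero => simp
  | succ x ih =>
    rw [Finset.sum_Icc_succ_top (by omega), Finset.sum_Icc_succ_top (by omega),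
      Finset.sum_Icc_succ_top (by omega) (f := fun n => F (n + 1) * (1 / (n : ℝ) - 1 / (n + 1)))]
    have : ∑ n ∈ Icc 1 x, F (n + 1) / n + F (x + 1 + 1) / (x + 1 : ℕ) -
        (∑ n ∈ Icc 1 x, F n / n + F (x + 1) / (x + 1 : ℕ)) =
        (∑ n ∈ Icc 1 x, F (n + 1) / n - ∑ n ∈ Icc 1 x, F n / n) +
          (F (x + 1 + 1) / (x + 1 : ℕ) - F (x + 1) / (x + 1 : ℕ)) := by ring
    rw [this, ih]
    push_cast
    ring

/-- A unit shift changes a logarithmic sum of a `1`-bounded function by at most `3`. [folklore] -/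
theorem abs_sum_shift_one_sub_le {F : ℕ → ℝ} (hF : ∀ n, |F n| ≤ 1) (x : ℕ) :
    |∑ n ∈ Icc 1 x, F (n + 1) / n - ∑ n ∈ Icc 1 x, F n / n| ≤ 3 := by
  rw [sum_shift_one_sub_eq]
  have h1 : |∑ n ∈ Icc 1 x, F (n + 1) * (1 / n - 1 / (n + 1))| ≤ 1 := by
    calc |∑ n ∈ Icc 1 x, F (n + 1) * (1 / n - 1 / (n + 1))|
        ≤ ∑ n ∈ Icc 1 x, |F (n + 1) * (1 / n - 1 / (n + 1))| := Finset.abs_sum_le_sum_abs _ _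
      _ ≤ ∑ n ∈ Icc 1 x, ((1 : ℝ) / n - 1 / (n + 1)) := Finset.sum_le_sum fun n hn => by
          have hn1 : (1 : ℝ) ≤ n := by exact_mod_cast (Finset.mem_Icc.mp hn).1
          have hpos : 0 ≤ (1 : ℝ) / n - 1 / (n + 1) := by
            rw [sub_nonneg]; exact one_div_le_one_div_of_le (by linarith) (by linarith)
          rw [abs_mul, abs_of_nonneg hpos]
          exact mul_le_of_le_one_left hpos (hF _)
      _ = 1 - 1 / (x + 1) := sum_inv_sub_inv_succ x
      _ ≤ 1 := by
          have : (0 : ℝ) ≤ 1 / (x + 1) := by positivity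
          linarith
  have h2 : |F (x + 1) / (x + 1)| ≤ 1 := by
    rw [abs_div, abs_of_pos (by positivity : (0 : ℝ) < x + 1)]
    exact (div_le_one (by positivity)).mpr ((hF _).trans (by linarith))
  have h3 : |F 1| ≤ 1 := hF 1
  calc _ ≤ |∑ n ∈ Icc 1 x, F (n + 1) * (1 / n - 1 / (n + 1)) + F (x + 1) / (x + 1)| + |F 1| := abs_sub _ _
    _ ≤ |∑ n ∈ Icc 1 x, F (n + 1) * (1 / n - 1 / (n + 1))| + |F (x + 1) / (x + 1)| + |F 1| :=
        add_le_add (abs_add_le _ _) le_rfl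
    _ ≤ 1 + 1 + 1 := by linarith
    _ = 3 := by norm_num

/-- **Shifting a logarithmic average** (crude form of the total variation bound of §4):
`|∑_{n ≤ x} F(n+j)/n - ∑_{n ≤ x} F(n)/n| ≤ 3j` for `1`-bounded `F`.
[cite: TaoTeravainenJTNB2018, §4 (total variation bound)] -/
theorem abs_sum_shift_sub_le {F : ℕ → ℝ} (hF : ∀ n, |F n| ≤ 1) (x j : ℕ) :
    |∑ n ∈ Icc 1 x, F (n + j) / n - ∑ n ∈ Icc 1 x, F n / n| ≤ 3 * j := by
  induction j with
  | zero => simp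
  | succ j ih =>
    have h1 := abs_sum_shift_one_sub_le (F := fun n => F (n + j)) (fun n => hF _) x
    have h1' : |∑ n ∈ Icc 1 x, F (n + (j + 1)) / n - ∑ n ∈ Icc 1 x, F (n + j) / n| ≤ 3 := by
      have heq : ∀ n, F (n + (j + 1)) = F (n + 1 + j) := fun n => by ring_nf
      simp only [heq]; exact h1
    calc |∑ n ∈ Icc 1 x, F (n + (j + 1)) / n - ∑ n ∈ Icc 1 x, F n / n|
        ≤ |∑ n ∈ Icc 1 x, F (n + (j + 1)) / n - ∑ n ∈ Icc 1 x, F (n + j) / n| +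
            |∑ n ∈ Icc 1 x, F (n + j) / n - ∑ n ∈ Icc 1 x, F n / n| := abs_sub_le _ _ _
      _ ≤ 3 + 3 * j := add_le_add h1' ih
      _ = 3 * (j + 1 : ℕ) := by push_cast; ring

/-! ### Abel summation -/

/-- The Abel summation identity for `∑_{lo < d ≤ hi} g(d) ω(d)` with partial sums `A(h) = ∑_{d ≤ h} g(d)`.
[folklore] -/
theorem abel_identity (g ω : ℕ → ℝ) {lo hi : ℕ} (h : lo + 1 ≤ hi) :
    ∑ d ∈ Ioc lo hi, g d * ω d =
      (∑ d ∈ Icc 1 hi, g d) * ω hi - (∑ d ∈ Icc 1 lo, g d) * ω (lo + 1) +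
        ∑ d ∈ Ico (lo + 1) hi, (∑ e ∈ Icc 1 d, g e) * (ω d - ω (d + 1)) := by
  induction hi, h using Nat.le_induction with
  | base =>
    rw [Nat.Ioc_succ_singleton, Finset.sum_singleton, Finset.Ico_self, Finset.sum_empty,
      Finset.sum_Icc_succ_top (by omega)]
    ring
  | succ hi hhi ih =>
    rw [Finset.sum_Ioc_succ_top (by omega), ih, Finset.sum_Ico_succ_top hhi,
      Finset.sum_Icc_succ_top (by omega) (b := hi)]
    ring

/-- Telescoping of the weight differences. [folklore] -/
theorem sum_Ico_sub_succ (ω : ℕ → ℝ) {lo hi : ℕ} (h : lo + 1 ≤ hi) :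
    ∑ d ∈ Ico (lo + 1) hi, (ω d - ω (d + 1)) = ω (lo + 1) - ω hi := by
  induction hi, h using Nat.le_induction with
  | base => simp
  | succ hi hhi ih => rw [Finset.sum_Ico_succ_top hhi, ih]; ring

/-- **Abel summation bound**: for non-negative non-increasing weights `ω` on `(lo, hi]` and partial sums
`|∑_{d ≤ h} g(d)| ≤ P` for `lo ≤ h ≤ hi`, `|∑_{lo < d ≤ hi} g(d) ω(d)| ≤ 2 P ω(lo+1)`.
[cite: TaoTeravainenJTNB2018, §5 ("By summation by parts")] -/
theorem abel_bound {g ω : ℕ → ℝ} {lo hi : ℕ} (hlohi : lo < hi) {P : ℝ}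
    (hω0 : ∀ d, lo < d → d ≤ hi → 0 ≤ ω d) (hωanti : ∀ d, lo < d → d < hi → ω (d + 1) ≤ ω d)
    (hP : ∀ h, lo ≤ h → h ≤ hi → |∑ d ∈ Icc 1 h, g d| ≤ P) :
    |∑ d ∈ Ioc lo hi, g d * ω d| ≤ 2 * P * ω (lo + 1) := by
  have hP0 : 0 ≤ P := (abs_nonneg _).trans (hP lo le_rfl hlohi.le)
  rw [abel_identity g ω (Nat.succ_le_of_lt hlohi)]
  have h1 : |(∑ d ∈ Icc 1 hi, g d) * ω hi| ≤ P * ω hi := by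
    rw [abs_mul, abs_of_nonneg (hω0 hi hlohi le_rfl)]
    exact mul_le_mul_of_nonneg_right (hP hi hlohi.le le_rfl) (hω0 hi hlohi le_rfl)
  have h2 : |(∑ d ∈ Icc 1 lo, g d) * ω (lo + 1)| ≤ P * ω (lo + 1) := by
    rw [abs_mul, abs_of_nonneg (hω0 (lo + 1) (Nat.lt_succ_self _) (Nat.succ_le_of_lt hlohi))]
    exact mul_le_mul_of_nonneg_right (hP lo le_rfl hlohi.le)
      (hω0 (lo + 1) (Nat.lt_succ_self _) (Nat.succ_le_of_lt hlohi))
  have h3 : |∑ d ∈ Ico (lo + 1) hi, (∑ e ∈ Icc 1 d, g e) * (ω d - ω (d + 1))| ≤ P * (ω (lo + 1) - ω hi) := by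
    calc |∑ d ∈ Ico (lo + 1) hi, (∑ e ∈ Icc 1 d, g e) * (ω d - ω (d + 1))|
        ≤ ∑ d ∈ Ico (lo + 1) hi, |(∑ e ∈ Icc 1 d, g e) * (ω d - ω (d + 1))| := Finset.abs_sum_le_sum_abs _ _
      _ ≤ ∑ d ∈ Ico (lo + 1) hi, P * (ω d - ω (d + 1)) := Finset.sum_le_sum fun d hd => by
          rw [Finset.mem_Ico] at hd
          have hdiff : 0 ≤ ω d - ω (d + 1) := sub_nonneg.mpr (hωanti d (by omega) hd.2)
          rw [abs_mul, abs_of_nonneg hdiff]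
          exact mul_le_mul_of_nonneg_right (hP d (by omega) hd.2.le) hdiff
      _ = P * (ω (lo + 1) - ω hi) := by rw [← Finset.mul_sum, sum_Ico_sub_succ ω (Nat.succ_le_of_lt hlohi)]
  calc _ ≤ |(∑ d ∈ Icc 1 hi, g d) * ω hi - (∑ d ∈ Icc 1 lo, g d) * ω (lo + 1)| +
        |∑ d ∈ Ico (lo + 1) hi, (∑ e ∈ Icc 1 d, g e) * (ω d - ω (d + 1))| := abs_add_le _ _
    _ ≤ (|(∑ d ∈ Icc 1 hi, g d) * ω hi| + |(∑ d ∈ Icc 1 lo, g d) * ω (lo + 1)|) +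
        |∑ d ∈ Ico (lo + 1) hi, (∑ e ∈ Icc 1 d, g e) * (ω d - ω (d + 1))| :=
        add_le_add (abs_sub _ _) le_rfl
    _ ≤ P * ω hi + P * ω (lo + 1) + P * (ω (lo + 1) - ω hi) := by linarith
    _ = 2 * P * ω (lo + 1) := by ring

/-! ### Comparing two weightings of an average -/

/-- If the weights `v` are `λ u (1 + η)` with `|η| ≤ e ≤ ½`, the `v`- and `u`-weighted averages of a `1`-bounded
function differ by at most `4e`. (Used for `1/p` versus `(log p)/p` on a dyadic block, `e = 1/m`.) [folklore] -/
theorem abs_wavg_sub_wavg_le {ι : Type*} (P : Finset ι) (u η G : ι → ℝ) {la e : ℝ} (hla : 0 < la)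
    (hu : ∀ i ∈ P, 0 < u i) (hP : P.Nonempty) (hη : ∀ i ∈ P, |η i| ≤ e) (he : e ≤ 1 / 2)
    (hG : ∀ i ∈ P, |G i| ≤ 1) :
    |(∑ i ∈ P, la * u i * (1 + η i) * G i) / (∑ i ∈ P, la * u i * (1 + η i)) -
      (∑ i ∈ P, u i * G i) / (∑ i ∈ P, u i)| ≤ 4 * e := by
  have hU : 0 < ∑ i ∈ P, u i := Finset.sum_pos hu hP
  set U := ∑ i ∈ P, u i with hUdef
  have he0 : 0 ≤ e := by obtain ⟨i, hi⟩ := hP; exact (abs_nonneg _).trans (hη i hi)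
  -- normalised moments
  set a := (∑ i ∈ P, u i * G i) / U with ha
  set b := (∑ i ∈ P, u i * (η i * G i)) / U with hb
  set d := (∑ i ∈ P, u i * η i) / U with hd
  have hbd : ∀ (φ : ι → ℝ), (∀ i ∈ P, |φ i| ≤ e) → |(∑ i ∈ P, u i * φ i) / U| ≤ e := by
    intro φ hφ
    rw [abs_div, abs_of_pos hU, div_le_iff₀ hU, Finset.mul_sum]
    calc |∑ i ∈ P, u i * φ i| ≤ ∑ i ∈ P, |u i * φ i| := Finset.abs_sum_le_sum_abs _ _
      _ ≤ ∑ i ∈ P, e * u i := Finset.sum_le_sum fun i hi => by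
          rw [abs_mul, abs_of_pos (hu i hi), mul_comm]
          exact mul_le_mul_of_nonneg_right (hφ i hi) (hu i hi).le
  have ha1 : |a| ≤ 1 := by
    have h1 : |(∑ i ∈ P, u i * G i) / U| ≤ 1 := by
      rw [abs_div, abs_of_pos hU, div_le_iff₀ hU, Finset.mul_sum]
      calc |∑ i ∈ P, u i * G i| ≤ ∑ i ∈ P, |u i * G i| := Finset.abs_sum_le_sum_abs _ _
        _ ≤ ∑ i ∈ P, 1 * u i := Finset.sum_le_sum fun i hi => by
            rw [abs_mul, abs_of_pos (hu i hi), mul_comm]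
            exact mul_le_mul_of_nonneg_right (hG i hi) (hu i hi).le
    exact h1
  have hb1 : |b| ≤ e := hbd (fun i => η i * G i) fun i hi => by
    rw [abs_mul]
    calc |η i| * |G i| ≤ e * 1 := mul_le_mul (hη i hi) (hG i hi) (abs_nonneg _) he0
      _ = e := mul_one e
  have hd1 : |d| ≤ e := hbd η hη
  -- the two averages in terms of `a, b, d`
  have hnum : ∑ i ∈ P, la * u i * (1 + η i) * G i = la * U * (a + b) := by
    have e : la * U * (a + b) = la * (∑ i ∈ P, u i * G i + ∑ i ∈ P, u i * (η i * G i)) := by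
      rw [ha, hb]; field_simp
    rw [e, ← Finset.sum_add_distrib, Finset.mul_sum]
    exact Finset.sum_congr rfl fun i _ => by ring
  have hden : ∑ i ∈ P, la * u i * (1 + η i) = la * U * (1 + d) := by
    have e : la * U * (1 + d) = la * (U + ∑ i ∈ P, u i * η i) := by
      rw [hd]; field_simp
    rw [e, hUdef, ← Finset.sum_add_distrib, Finset.mul_sum]
    exact Finset.sum_congr rfl fun i _ => by ring
  have h1d : 1 / 2 ≤ 1 + d := by have := (abs_le.mp hd1).1; linarith
  have h1d0 : 0 < 1 + d := by linarith
  rw [hnum, hden, mul_div_mul_left _ _ (mul_pos hla hU).ne']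
  have key : (a + b) / (1 + d) - a = (b - a * d) / (1 + d) := by field_simp; ring
  rw [key, abs_div, abs_of_pos h1d0, div_le_iff₀ h1d0]
  have hbad : |b - a * d| ≤ 2 * e := by
    calc |b - a * d| ≤ |b| + |a * d| := abs_sub _ _
      _ = |b| + |a| * |d| := by rw [abs_mul]
      _ ≤ e + 1 * e := add_le_add hb1 (mul_le_mul ha1 hd1 (abs_nonneg _) zero_le_one)
      _ = 2 * e := by ring
  nlinarith

/-! ### Integers coprime to `W` in a dyadic block: counting and residue classes -/

/-- In `W` consecutive integers exactly `φ(W)` are coprime to `W` (Mathlib). [folklore] -/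
theorem card_filter_coprime_Ico (W t : ℕ) :
    ((Ico (t * W) (t * W + W)).filter fun n => Nat.Coprime W n).card = Nat.totient W :=
  Nat.filter_coprime_Ico_eq_totient W (t * W)

/-- **Lower bound for the number of integers coprime to `W` in a dyadic block**: at least
`φ(W) (2^m / W - 1)` (count the complete residue systems `[tW, tW + W)` inside the block). [folklore] -/
theorem totient_mul_le_card_roughBlock {W : ℕ} (hW : 1 ≤ W) (m : ℕ) :
    Nat.totient W * (2 ^ m / W - 1) ≤ (roughBlock W m).card := by
  classical
  set t₀ := 2 ^ m / W + 1 with ht₀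
  set t₁ := 2 ^ (m + 1) / W with ht₁
  -- the union of the complete residue systems indexed by `t ∈ [t₀, t₁)` lies in the block
  have hsub : (Ico t₀ t₁).biUnion (fun t => (Ico (t * W) (t * W + W)).filter fun n => Nat.Coprime W n) ⊆
      roughBlock W m := by
    intro n hn
    rw [Finset.mem_biUnion] at hn
    obtain ⟨t, ht, hn⟩ := hn
    rw [Finset.mem_Ico] at ht
    rw [Finset.mem_filter, Finset.mem_Ico] at hn
    refine mem_roughBlock.mpr ⟨⟨?_, ?_⟩, hn.2⟩
    · -- `n ≥ tW ≥ t₀ W > 2^m`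
      have h1 : 2 ^ m < t₀ * W := by rw [ht₀]; exact Nat.lt_div_mul_add hW |>.trans_le (by ring_nf; omega)
      have h2 : t₀ * W ≤ t * W := Nat.mul_le_mul_right W ht.1
      omega
    · -- `n < tW + W ≤ t₁ W ≤ 2^{m+1}`
      have h1 : t * W + W ≤ t₁ * W := by
        have : (t + 1) * W ≤ t₁ * W := Nat.mul_le_mul_right W ht.2
        linarith [this]
      have h2 : t₁ * W ≤ 2 ^ (m + 1) := by rw [ht₁]; exact Nat.div_mul_le_self _ _
      omega
  have hdisj : ((Ico t₀ t₁ : Finset ℕ) : Set ℕ).PairwiseDisjoint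
      (fun t => (Ico (t * W) (t * W + W)).filter fun n => Nat.Coprime W n) := by
    intro t _ t' _ htt'
    simp only [Function.onFun]
    rw [Finset.disjoint_left]
    intro n hn hn'
    rw [Finset.mem_filter, Finset.mem_Ico] at hn hn'
    apply htt'
    -- `n / W = t = t'`
    have h1 : n / W = t := Nat.div_eq_of_lt_le (by linarith [hn.1.1]) (by linarith [hn.1.2])
    have h2 : n / W = t' := Nat.div_eq_of_lt_le (by linarith [hn'.1.1]) (by linarith [hn'.1.2])
    omega
  calc Nat.totient W * (2 ^ m / W - 1)
      ≤ Nat.totient W * (t₁ - t₀) := by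
        apply Nat.mul_le_mul_left
        have : 2 * (2 ^ m / W) ≤ 2 ^ (m + 1) / W := by
          rw [pow_succ, mul_comm (2 ^ m) 2]
          exact Nat.mul_div_le_mul_div_assoc 2 (2 ^ m) W |>.trans le_rfl
        omega
    _ = ∑ t ∈ Ico t₀ t₁, ((Ico (t * W) (t * W + W)).filter fun n => Nat.Coprime W n).card := by
        rw [Finset.sum_congr rfl (fun t _ => card_filter_coprime_Ico W t), Finset.sum_const, Nat.card_Ico,
          smul_eq_mul, mul_comm]
    _ = ((Ico t₀ t₁).biUnion fun t => (Ico (t * W) (t * W + W)).filter fun n => Nat.Coprime W n).card :=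
        (Finset.card_biUnion hdisj).symm
    _ ≤ (roughBlock W m).card := Finset.card_le_card hsub

/-- **Lower bound for `∑_{n ∈ block, (n,W)=1} 1/n`**: at least `φ(W)/(4W)` once `2^m ≥ 4W`. [folklore] -/
theorem roughBlock_sum_inv_ge {W m : ℕ} (hW : 1 ≤ W) (hm : 4 * W ≤ 2 ^ m) :
    (Nat.totient W : ℝ) / (4 * W) ≤ ∑ n ∈ roughBlock W m, (1 : ℝ) / n := by
  have hWr : (0 : ℝ) < W := by exact_mod_cast hW
  have h2m : (0 : ℝ) < 2 ^ m := by positivity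
  have hcard := totient_mul_le_card_roughBlock hW m
  -- each term is at least `1/2^{m+1}`
  have hterm : ∀ n ∈ roughBlock W m, (1 : ℝ) / 2 ^ (m + 1) ≤ 1 / n := by
    intro n hn
    have h := (mem_roughBlock.mp hn).1
    have hn0 : (0 : ℝ) < n := by exact_mod_cast (by omega : 0 < n)
    exact one_div_le_one_div_of_le hn0 (by exact_mod_cast h.2)
  have hq : (2 : ℝ) ^ m / W - 2 ≤ ((2 ^ m / W - 1 : ℕ) : ℝ) := by
    have h1 : ((2 ^ m / W : ℕ) : ℝ) ≥ (2 : ℝ) ^ m / W - 1 := by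
      have := Nat.lt_div_mul_add hW (a := 2 ^ m)
      have h2 : ((2 ^ m : ℕ) : ℝ) < (2 ^ m / W : ℕ) * W + W := by exact_mod_cast this
      push_cast at h2
      rw [ge_iff_le, sub_le_iff_le_add, div_le_iff₀ hWr]
      linarith
    have h3 : 1 ≤ 2 ^ m / W := (Nat.le_div_iff_mul_le hW).mpr (by linarith)
    push_cast [Nat.cast_sub h3]
    linarith
  have hφ0 : (0 : ℝ) ≤ Nat.totient W := by positivity
  have hkey : (1 : ℝ) / (4 * W) ≤ ((2 : ℝ) ^ m / W - 2) * (1 / 2 ^ (m + 1)) := by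
    have e : ((2 : ℝ) ^ m / W - 2) * (1 / 2 ^ (m + 1)) = 1 / (2 * W) - 1 / 2 ^ m := by
      rw [pow_succ]; field_simp
    rw [e]
    have h4 : (4 : ℝ) * W ≤ 2 ^ m := by exact_mod_cast hm
    have h5 : (1 : ℝ) / 2 ^ m ≤ 1 / (4 * W) := one_div_le_one_div_of_le (by positivity) h4
    have h6 : (1 : ℝ) / (4 * W) + 1 / (4 * W) = 1 / (2 * W) := by field_simp; norm_num
    linarith
  calc (Nat.totient W : ℝ) / (4 * W) = Nat.totient W * (1 / (4 * W)) := by ring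
    _ ≤ Nat.totient W * (((2 : ℝ) ^ m / W - 2) * (1 / 2 ^ (m + 1))) := mul_le_mul_of_nonneg_left hkey hφ0
    _ = (Nat.totient W * ((2 : ℝ) ^ m / W - 2)) * (1 / 2 ^ (m + 1)) := by ring
    _ ≤ (Nat.totient W * ((2 ^ m / W - 1 : ℕ) : ℝ)) * (1 / 2 ^ (m + 1)) := by
        gcongr
    _ ≤ ((roughBlock W m).card : ℝ) * (1 / 2 ^ (m + 1)) := by
        gcongr
        exact_mod_cast hcard
    _ = ∑ _n ∈ roughBlock W m, (1 : ℝ) / 2 ^ (m + 1) := by rw [Finset.sum_const, nsmul_eq_mul]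
    _ ≤ ∑ n ∈ roughBlock W m, (1 : ℝ) / n := Finset.sum_le_sum hterm

/-- The range of `d` with `W d + b` in the dyadic block: `d ∈ (⌊(2^m - b)/W⌋, ⌊(2^{m+1} - b)/W⌋]`. [folklore] -/
def dRange (W b m : ℕ) : Finset ℕ := Ioc ((2 ^ m - b) / W) ((2 ^ (m + 1) - b) / W)

/-- Membership in `dRange` is the block condition on `W d + b` (for `b ≤ 2^m`, `W ≥ 1`). [folklore] -/
theorem mem_dRange_iff {W b m : ℕ} (hW : 1 ≤ W) (hb : b ≤ 2 ^ m) {d : ℕ} :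
    d ∈ dRange W b m ↔ 2 ^ m < W * d + b ∧ W * d + b ≤ 2 ^ (m + 1) := by
  rw [dRange, Finset.mem_Ioc, Nat.div_lt_iff_lt_mul hW, Nat.le_div_iff_mul_le hW, Nat.mul_comm d W]
  have : b ≤ 2 ^ (m + 1) := hb.trans (Nat.pow_le_pow_right (by norm_num) (by omega))
  have key : ∀ y : ℕ, (2 ^ m - b < y ∧ y ≤ 2 ^ (m + 1) - b) ↔ (2 ^ m < y + b ∧ y + b ≤ 2 ^ (m + 1)) :=
    fun y => by omega
  exact key (W * d)

/-- **Residue-class decomposition of a sum over the rough block**: `n = W d + b` with `b` a reduced residue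
and `d ∈ dRange W b m` (`1 ≤ W ≤ 2^m`). [cite: TaoTeravainenJTNB2018, §5 ("Partitioning into residue classes
modulo `W`")] -/
theorem sum_roughBlock_eq_sum_residues {W m : ℕ} (hW : 1 ≤ W) (hWm : W ≤ 2 ^ m) (F : ℕ → ℝ) :
    ∑ n ∈ roughBlock W m, F n =
      ∑ b ∈ (range W).filter (fun b => Nat.Coprime W b), ∑ d ∈ dRange W b m, F (W * d + b) := by
  classical
  -- group by residues
  have hmaps : ∀ n ∈ roughBlock W m, n % W ∈ (range W).filter fun b => Nat.Coprime W b := by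
    intro n hn
    refine Finset.mem_filter.mpr ⟨Finset.mem_range.mpr (Nat.mod_lt _ hW), ?_⟩
    have hc := (mem_roughBlock.mp hn).2
    have : n = W * (n / W) + n % W := (Nat.div_add_mod n W).symm
    rw [this, Nat.coprime_mul_left_add_right] at hc
    exact hc
  rw [← Finset.sum_fiberwise_of_maps_to hmaps]
  refine Finset.sum_congr rfl fun b hb => ?_
  have hbW : b < W := Finset.mem_range.mp (Finset.mem_filter.mp hb).1
  have hbcop : Nat.Coprime W b := (Finset.mem_filter.mp hb).2
  have hbm : b ≤ 2 ^ m := (hbW.le).trans hWm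
  -- reindex the fibre by `d = n / W`
  refine Finset.sum_nbij' (fun n => n / W) (fun d => W * d + b) ?_ ?_ ?_ ?_ ?_
  · intro n hn
    rw [Finset.mem_filter] at hn
    obtain ⟨hn, hnb⟩ := hn
    have h := (mem_roughBlock.mp hn).1
    have hdecomp : W * (n / W) + b = n := by rw [← hnb]; exact Nat.div_add_mod n W
    rw [mem_dRange_iff hW hbm, hdecomp]
    exact h
  · intro d hd
    rw [mem_dRange_iff hW hbm] at hd
    refine Finset.mem_filter.mpr ⟨mem_roughBlock.mpr ⟨hd, ?_⟩, ?_⟩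
    · rwa [Nat.coprime_mul_left_add_right]
    · rw [Nat.mul_add_mod_self_left, Nat.mod_eq_of_lt hbW]
  · intro n hn
    rw [Finset.mem_filter] at hn
    conv_rhs => rw [← Nat.div_add_mod n W, hn.2]
  · intro d _
    rw [Nat.add_comm, Nat.add_mul_div_left _ _ hW, Nat.div_eq_of_lt hbW, zero_add]
  · intro n hn
    rw [Finset.mem_filter] at hn
    congr 1
    conv_lhs => rw [← Nat.div_add_mod n W, hn.2]

/-! ### Primes of the block versus the rough block -/

/-- A prime `p > w` is coprime to `W = ∏_{q ≤ w} q`. [folklore] -/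
theorem coprime_primorial_of_lt {w p : ℕ} (hp : p.Prime) (hwp : w < p) : Nat.Coprime (primorial w) p := by
  refine ((Nat.Prime.coprime_iff_not_dvd hp).mpr fun h => ?_).symm
  have hmem : p ∈ (primorial w).primeFactors := Nat.mem_primeFactors.mpr ⟨hp, h, primorial_ne_zero w⟩
  rw [primeFactors_primorial] at hmem
  have := Nat.le_of_mem_primesLE hmem
  omega

/-- For `2^m ≥ w`, the primes of the block are exactly the primes of the rough block. [folklore] -/
theorem roughBlock_filter_prime {w m : ℕ} (hwm : w ≤ 2 ^ m) :
    (roughBlock (primorial w) m).filter Nat.Prime = primeBlock m := by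
  ext p
  simp only [roughBlock, primeBlock, Finset.mem_filter, Finset.mem_Ioc]
  constructor
  · rintro ⟨⟨h1, -⟩, hp⟩; exact ⟨h1, hp⟩
  · rintro ⟨h1, hp⟩; exact ⟨⟨h1, coprime_primorial_of_lt hp (by omega)⟩, hp⟩

/-- `∑_{n ∈ rough block} Λ'(n) H(n) = ∑_{p ∈ prime block} (log p) H(p)` for `2^m ≥ w`.
[cite: TaoTeravainenJTNB2018, §5 (first two displays of the proof of Theorem 3.2)] -/
theorem sum_roughBlock_vonMangoldtPrime {w m : ℕ} (hwm : w ≤ 2 ^ m) (H : ℕ → ℝ) :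
    ∑ n ∈ roughBlock (primorial w) m, vonMangoldtPrime n * H n = ∑ p ∈ primeBlock m, Real.log p * H p := by
  rw [← roughBlock_filter_prime hwm, Finset.sum_filter]
  refine Finset.sum_congr rfl fun n _ => ?_
  unfold vonMangoldtPrime
  split_ifs <;> simp

/-- The weighted prime sum `∑_{p ∈ block} G(p) (log p)/p`. [folklore] -/
def primeLogSum (m : ℕ) (G : ℕ → ℝ) : ℝ := ∑ p ∈ primeBlock m, G p * Real.log p / p

/-- The rough sum `S₁(G) = ∑_{n ∈ rough block} G(n)/n`. [folklore] -/
def roughSum (W m : ℕ) (G : ℕ → ℝ) : ℝ := ∑ n ∈ roughBlock W m, G n / n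

/-- The residue-class sum `T_b(G) = ∑_{d ∈ dRange} (Λ'_{b,W}(d) - 1) G(Wd+b)/(Wd+b)`.
[cite: TaoTeravainenJTNB2018, §5 (display with `Λ_{b,W}(d) - 1`)] -/
def residueSum (W b m : ℕ) (G : ℕ → ℝ) : ℝ :=
  ∑ d ∈ dRange W b m, (vonMangoldtW W b d - 1) * (G (W * d + b) / (W * d + b : ℕ))

/-- **(E1)** `∑_b T_b(G) = (φ(W)/W) ∑_p G(p) log p / p - S₁(G)` (`W = ∏_{p ≤ w} p`, `w ≤ W ≤ 2^m`).
[cite: TaoTeravainenJTNB2018, §5 (proof of Theorem 3.2, first four displays)] -/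
theorem sum_residueSum_eq {w m : ℕ} (hw : 1 ≤ primorial w) (hWm : primorial w ≤ 2 ^ m) (hwm : w ≤ 2 ^ m)
    (G : ℕ → ℝ) :
    ∑ b ∈ (range (primorial w)).filter (fun b => Nat.Coprime (primorial w) b), residueSum (primorial w) b m G =
      (Nat.totient (primorial w) : ℝ) / primorial w * primeLogSum m G - roughSum (primorial w) m G := by
  set W := primorial w with hW
  have key := sum_roughBlock_eq_sum_residues hw hWm
    (fun n => ((Nat.totient W : ℝ) / W * vonMangoldtPrime n - 1) * (G n / n))
  simp only [residueSum, vonMangoldtW]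
  rw [← key, Finset.sum_congr rfl fun n _ => sub_mul _ _ _, Finset.sum_sub_distrib]
  congr 1
  · rw [primeLogSum]
    have h1 : ∑ n ∈ roughBlock W m, (Nat.totient W : ℝ) / W * vonMangoldtPrime n * (G n / n) =
        (Nat.totient W : ℝ) / W * ∑ n ∈ roughBlock W m, vonMangoldtPrime n * (G n / n) := by
      rw [Finset.mul_sum]; exact Finset.sum_congr rfl fun n _ => by ring
    rw [h1, sum_roughBlock_vonMangoldtPrime hwm (fun n => G n / n), Finset.mul_sum, Finset.mul_sum]
    exact Finset.sum_congr rfl fun p _ => by ring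
  · rw [roughSum]
    exact Finset.sum_congr rfl fun n _ => one_mul _

/-- `Q(G) = (∑_p G(p) log p/p) / (∑_p log p/p)` versus `𝔼^{log}_p G`: `|𝔼^{log}_p G - Q(G)| ≤ 4/m` for `m ≥ 2`
("since `Λ(p) = log(2^m) + O(1)` when `p` is a prime with `2^m < p ≤ 2^{m+1}`").
[cite: TaoTeravainenJTNB2018, §5 (first display of the proof of Theorem 3.2)] -/
theorem abs_primeLogAvg_sub_ratio_le {m : ℕ} (hm : 2 ≤ m) {G : ℕ → ℝ} (hG : ∀ n, |G n| ≤ 1) :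
    |primeLogAvg m G - primeLogSum m G / primeLogSum m (fun _ => 1)| ≤ 4 / m := by
  have hm0 : (0 : ℝ) < m := by exact_mod_cast (by omega : 0 < m)
  have hlog2 : 0 < Real.log 2 := Real.log_pos one_lt_two
  set la : ℝ := m * Real.log 2 with hla
  have hla0 : 0 < la := mul_pos hm0 hlog2
  set u : ℕ → ℝ := fun p => 1 / p with hu
  set η : ℕ → ℝ := fun p => Real.log p / la - 1 with hη
  have hmem : ∀ p ∈ primeBlock m, (2 : ℝ) ^ m < p ∧ (p : ℝ) ≤ 2 ^ (m + 1) ∧ 0 < (p : ℝ) := by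
    intro p hp
    have h := (mem_primeBlock.mp hp).1
    refine ⟨by exact_mod_cast h.1, by exact_mod_cast h.2, ?_⟩
    have : (0 : ℝ) < 2 ^ m := by positivity
    have h1 : (2 : ℝ) ^ m < p := by exact_mod_cast h.1
    linarith
  have hηb : ∀ p ∈ primeBlock m, |η p| ≤ 1 / m := by
    intro p hp
    obtain ⟨h1, h2, hp0⟩ := hmem p hp
    have hl1 : la < Real.log p := by
      rw [hla, ← Real.log_rpow two_pos, Real.rpow_natCast]; exact Real.log_lt_log (by positivity) h1
    have hl2 : Real.log p ≤ la + Real.log 2 := by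
      have : Real.log p ≤ Real.log ((2 : ℝ) ^ (m + 1)) := Real.log_le_log hp0 h2
      rw [Real.log_pow] at this; push_cast at this; rw [hla]; linarith
    rw [hη]
    simp only
    rw [abs_le]
    constructor
    · have : 0 ≤ Real.log p / la - 1 := by rw [sub_nonneg, le_div_iff₀ hla0]; linarith
      have : (0 : ℝ) ≤ 1 / m := by positivity
      linarith
    · rw [sub_le_iff_le_add, div_le_iff₀ hla0]
      have : (1 / (m : ℝ) + 1) * la = la + Real.log 2 := by rw [hla]; field_simp; ring
      linarith
  have hweights : ∀ p ∈ primeBlock m, la * u p * (1 + η p) = Real.log p / p := by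
    intro p hp
    obtain ⟨-, -, hp0⟩ := hmem p hp
    simp only [hu, hη]; field_simp; ring
  have h := abs_wavg_sub_wavg_le (primeBlock m) u η G hla0 (fun p hp => by
      obtain ⟨-, -, hp0⟩ := hmem p hp; simp only [hu]; positivity)
    (primeBlock_nonempty m) hηb (one_div_le_one_div_of_le two_pos (by exact_mod_cast hm))
    (fun p _ => hG p)
  have e1 : ∑ p ∈ primeBlock m, la * u p * (1 + η p) * G p = primeLogSum m G := by
    rw [primeLogSum]; refine Finset.sum_congr rfl fun p hp => ?_; rw [hweights p hp]; ring
  have e2 : ∑ p ∈ primeBlock m, la * u p * (1 + η p) = primeLogSum m (fun _ => 1) := by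
    rw [primeLogSum]; refine Finset.sum_congr rfl fun p hp => ?_; rw [hweights p hp]; ring
  have e3 : (∑ p ∈ primeBlock m, u p * G p) / (∑ p ∈ primeBlock m, u p) = primeLogAvg m G := by
    rw [primeLogAvg]; simp only [hu]; congr 1; refine Finset.sum_congr rfl fun p _ => ?_; ring
  rw [e1, e2, e3] at h
  have e4 : (4 : ℝ) * (1 / m) = 4 / m := by ring
  rw [e4, abs_sub_comm] at h
  exact h

/-- Comparing two ratios: `|A/B - A'/B'| ≤ (|A - A'| + |B - B'|)/B` when `B, B' > 0` and `|A'| ≤ B'`. [folklore] -/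
theorem abs_div_sub_div_le {A B A' B' : ℝ} (hB : 0 < B) (hB' : 0 < B') (hA' : |A'| ≤ B') :
    |A / B - A' / B'| ≤ (|A - A'| + |B - B'|) / B := by
  have key : A / B - A' / B' = (A - A') / B + (A' / B') * ((B' - B) / B) := by field_simp; ring
  rw [key]
  have h1 : |(A - A') / B| = |A - A'| / B := by rw [abs_div, abs_of_pos hB]
  have h2 : |A' / B' * ((B' - B) / B)| ≤ |B - B'| / B := by
    rw [abs_mul, abs_div, abs_div, abs_of_pos hB, abs_of_pos hB', abs_sub_comm B' B]
    have : |A'| / B' ≤ 1 := (div_le_one hB').mpr hA'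
    calc |A'| / B' * (|B - B'| / B) ≤ 1 * (|B - B'| / B) :=
          mul_le_mul_of_nonneg_right this (by positivity)
      _ = _ := one_mul _
  calc _ ≤ |(A - A') / B| + |A' / B' * ((B' - B) / B)| := abs_add_le _ _
    _ ≤ |A - A'| / B + |B - B'| / B := by rw [h1]; exact add_le_add le_rfl h2
    _ = _ := by ring

/-! ### From the bilinear estimate to the partial sums `P(h)` -/

/-- Integer and natural indexing of the same double sum over `[1,H]²`. [folklore] -/
theorem sum_Icc_int_prod_eq_sum_nat (H : ℕ) (Φ : ℤ × ℤ → ℝ) :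
    ∑ q ∈ Icc (1 : ℤ) H ×ˢ Icc (1 : ℤ) H, Φ q =
      ∑ q ∈ Icc 1 H ×ˢ Icc 1 H, Φ ((q.1 : ℤ), (q.2 : ℤ)) := by
  refine Finset.sum_nbij' (fun q => (q.1.toNat, q.2.toNat)) (fun q => ((q.1 : ℤ), (q.2 : ℤ))) ?_ ?_ ?_ ?_ ?_
  · intro q hq
    simp only [Finset.mem_product, Finset.mem_Icc] at hq ⊢
    omega
  · intro q hq
    simp only [Finset.mem_product, Finset.mem_Icc] at hq ⊢
    omega
  · intro q hq
    simp only [Finset.mem_product, Finset.mem_Icc] at hq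
    ext <;> simp <;> omega
  · intro q _
    ext <;> simp
  · intro q hq
    simp only [Finset.mem_product, Finset.mem_Icc] at hq
    congr 1
    ext <;> simp <;> omega

/-- `∑_{n ∈ [1, N]} f(n) = ∑_{i < N} f(i+1)`. [folklore] -/
theorem sum_Icc_one_eq_sum_range (N : ℕ) (f : ℕ → ℝ) : ∑ n ∈ Icc 1 N, f n = ∑ i ∈ range N, f (i + 1) := by
  induction N with
  | zero => simp
  | succ N ih => rw [Finset.sum_Icc_succ_top (by omega), ih, Finset.sum_range_succ]

/-- Splitting `i < V h` as `i = V q + r`, `q < h`, `r < V`. [folklore] -/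
theorem sum_range_mul_eq (V h : ℕ) (φ : ℕ → ℝ) :
    ∑ i ∈ range (V * h), φ i = ∑ r ∈ range V, ∑ q ∈ range h, φ (V * q + r) := by
  induction h with
  | zero => simp
  | succ h ih =>
    rw [Nat.mul_succ, Finset.sum_range_add, ih, ← Finset.sum_add_distrib]
    refine Finset.sum_congr rfl fun r _ => ?_
    rw [Finset.sum_range_succ]

/-- The double sum `∑_{d ∈ [1,h]} ∑_{n' ∈ [1, V h]} F(d, n')` regrouped along `n' = V(q-1) + r + 1`,
`(q, d) ∈ [1,h]²`, `r < V`. [folklore] -/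
theorem sum_Icc_Icc_mul_eq (V h : ℕ) (F : ℕ → ℕ → ℝ) :
    ∑ d ∈ Icc 1 h, ∑ n' ∈ Icc 1 (V * h), F d n' =
      ∑ r ∈ range V, ∑ q ∈ Icc 1 h ×ˢ Icc 1 h, F q.2 (V * (q.1 - 1) + r + 1) := by
  have step1 : ∀ d, ∑ n' ∈ Icc 1 (V * h), F d n' = ∑ r ∈ range V, ∑ q ∈ range h, F d (V * q + r + 1) := by
    intro d
    rw [sum_Icc_one_eq_sum_range, sum_range_mul_eq]
  simp_rw [step1]
  rw [Finset.sum_comm]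
  refine Finset.sum_congr rfl fun r _ => ?_
  rw [Finset.sum_product_right]
  refine Finset.sum_congr rfl fun d _ => ?_
  rw [sum_Icc_one_eq_sum_range]
  refine Finset.sum_congr rfl fun q _ => ?_
  simp

/-- **The partial sums `P(h) = ∑_{d ≤ h} (Λ'_{b,W}(d) - 1) f_x(a(Wd+b))` are small** — the content of the last
three displays of §5 (shift `n` by `n' ≤ aWh`, average, split `n'` modulo `aW`, apply Lemma 5.2 + 5.3): given the
bilinear estimate with `ε₁` at the scale `h` (hypothesis `hA`), `|P(h)| ≤ ε₁ h + 3 a W h² (1 + log(Wh+b)) / L_x`.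
[cite: TaoTeravainenJTNB2018, §5 (proof of Theorem 3.2, displays (targ) ff.)] -/
theorem abs_partialSum_le {s : ℕ} (c : Fin (s + 1) → ℕ) {W b a h x : ℕ} (hW : 1 ≤ W) (hb : 1 ≤ b) (ha : 1 ≤ a)
    (hx : 1 ≤ x) {ε₁ : ℝ}
    (hA : ∀ g : Fin (s + 1) → ℤ → ℝ, (∀ j y, |g j y| ≤ 1) →
      |∑ q ∈ Icc (1 : ℤ) h ×ˢ Icc (1 : ℤ) h,
          (vonMangoldtW W b q.2.toNat - 1) * ∏ j, g j (q.1 + c j * q.2)| ≤ ε₁ * (h : ℝ) ^ 2) :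
    |∑ d ∈ Icc 1 h, (vonMangoldtW W b d - 1) * corrAvg c x (a * (W * d + b))| ≤
      ε₁ * h + 3 * (a * W) * (h : ℝ) ^ 2 * (1 + Real.log ((W * h + b : ℕ) : ℝ)) / harm x := by
  rcases Nat.eq_zero_or_pos h with hh | hh
  · subst hh; simp
  set V : ℕ := a * W with hV
  have hV1 : 1 ≤ V := Nat.one_le_iff_ne_zero.mpr (Nat.mul_ne_zero (by omega) (by omega))
  set N' : ℕ := V * h with hN'
  have hN'1 : 1 ≤ N' := Nat.one_le_iff_ne_zero.mpr (Nat.mul_ne_zero (by omega) (by omega))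
  have hN'r : (0 : ℝ) < N' := by exact_mod_cast hN'1
  have hLx := harm_pos hx
  -- notation
  set θ : ℕ → ℝ := fun d => vonMangoldtW W b d - 1 with hθ
  set sp : ℕ → ℕ → ℝ := fun d n => signProd c (a * (W * d + b)) n with hsp
  have hsp1 : ∀ d n, |sp d n| ≤ 1 := fun d n => abs_signProd_le_one c _ n
  set Bθ : ℝ := 1 + Real.log ((W * h + b : ℕ) : ℝ) with hBθ
  have hθb : ∀ d ∈ Icc 1 h, |θ d| ≤ Bθ := by
    intro d hd
    rw [Finset.mem_Icc] at hd
    obtain ⟨h0, hle⟩ := vonMangoldtW_nonneg_le_log W b d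
    have hlog : Real.log ((W * d + b : ℕ) : ℝ) ≤ Real.log ((W * h + b : ℕ) : ℝ) := by
      apply Real.log_le_log (by exact_mod_cast (by omega : 0 < W * d + b))
      exact_mod_cast (by nlinarith [hd.2] : W * d + b ≤ W * h + b)
    have hlog0 : 0 ≤ Real.log ((W * d + b : ℕ) : ℝ) := Real.log_nonneg (by exact_mod_cast (by omega : 1 ≤ W * d + b))
    simp only [hθ, hBθ]
    rw [abs_le]; constructor <;> linarith
  have hBθ0 : 0 ≤ Bθ := (abs_nonneg _).trans (hθb 1 (Finset.mem_Icc.mpr ⟨le_rfl, hh⟩))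
  -- Step 1: the shift-averaged expression and its remainder
  set Rd : ℕ → ℝ := fun d =>
    ∑ n ∈ Icc 1 x, sp d n / n - (1 / N') * ∑ n' ∈ Icc 1 N', ∑ n ∈ Icc 1 x, sp d (n + n') / n with hRd
  have hRd_bound : ∀ d, |Rd d| ≤ 3 * N' := by
    intro d
    have hrepr : Rd d = (1 / N') * ∑ n' ∈ Icc 1 N', (∑ n ∈ Icc 1 x, sp d n / n - ∑ n ∈ Icc 1 x, sp d (n + n') / n) := by
      simp only [hRd]
      rw [Finset.sum_sub_distrib, Finset.sum_const, Nat.card_Icc, Nat.add_sub_cancel, nsmul_eq_mul, mul_sub]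
      field_simp
    rw [hrepr, abs_mul, abs_of_pos (by positivity : (0 : ℝ) < 1 / N')]
    calc 1 / (N' : ℝ) * |∑ n' ∈ Icc 1 N', (∑ n ∈ Icc 1 x, sp d n / n - ∑ n ∈ Icc 1 x, sp d (n + n') / n)|
        ≤ 1 / (N' : ℝ) * ∑ n' ∈ Icc 1 N', |∑ n ∈ Icc 1 x, sp d n / n - ∑ n ∈ Icc 1 x, sp d (n + n') / n| :=
          mul_le_mul_of_nonneg_left (Finset.abs_sum_le_sum_abs _ _) (by positivity)
      _ ≤ 1 / (N' : ℝ) * ∑ _n' ∈ Icc 1 N', (3 * N' : ℝ) := by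
          apply mul_le_mul_of_nonneg_left _ (by positivity)
          refine Finset.sum_le_sum fun n' hn' => ?_
          rw [abs_sub_comm]
          have := abs_sum_shift_sub_le (hsp1 d) x n'
          have hn'le : (n' : ℝ) ≤ N' := by exact_mod_cast (Finset.mem_Icc.mp hn').2
          linarith
      _ = 3 * N' := by rw [Finset.sum_const, Nat.card_Icc, Nat.add_sub_cancel, nsmul_eq_mul]; field_simp
  -- Step 2: the inner double sums are controlled by the bilinear estimate
  have hinner : ∀ n : ℕ, |∑ d ∈ Icc 1 h, ∑ n' ∈ Icc 1 N', θ d * sp d (n + n')| ≤ V * (ε₁ * (h : ℝ) ^ 2) := by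
    intro n
    have hsplit : ∑ d ∈ Icc 1 h, ∑ n' ∈ Icc 1 N', θ d * sp d (n + n') =
        ∑ r ∈ range V, ∑ q ∈ Icc 1 h ×ˢ Icc 1 h, θ q.2 * sp q.2 (n + (V * (q.1 - 1) + r + 1)) := by
      simp only [hN']
      exact sum_Icc_Icc_mul_eq V h (fun d n' => θ d * sp d (n + n'))
    rw [hsplit]
    -- for each `r` the sum is an instance of the bilinear estimate
    have hr : ∀ r ∈ range V,
        |∑ q ∈ Icc 1 h ×ˢ Icc 1 h, θ q.2 * sp q.2 (n + (V * (q.1 - 1) + r + 1))| ≤ ε₁ * (h : ℝ) ^ 2 := by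
      intro r _
      set g : Fin (s + 1) → ℤ → ℝ :=
        fun j y => lam (((n + r + 1 + a * b * c j : ℕ) : ℤ) + V * (y - 1)).toNat with hg
      have hg1 : ∀ j y, |g j y| ≤ 1 := fun j y => abs_lam_le_one _
      have hAg := hA g hg1
      rw [sum_Icc_int_prod_eq_sum_nat] at hAg
      have heq : ∀ q ∈ Icc 1 h ×ˢ Icc 1 h, θ q.2 * sp q.2 (n + (V * (q.1 - 1) + r + 1)) =
          (vonMangoldtW W b (((q.1 : ℕ) : ℤ), ((q.2 : ℕ) : ℤ)).2.toNat - 1) *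
            ∏ j, g j ((((q.1 : ℕ) : ℤ), ((q.2 : ℕ) : ℤ)).1 + c j * (((q.1 : ℕ) : ℤ), ((q.2 : ℕ) : ℤ)).2) := by
        intro q hq
        rw [Finset.mem_product, Finset.mem_Icc, Finset.mem_Icc] at hq
        simp only [Int.toNat_natCast, hθ, hsp, signProd]
        congr 1
        refine Finset.prod_congr rfl fun j _ => ?_
        simp only [hg]
        congr 1
        have hq1 : ((q.1 - 1 : ℕ) : ℤ) = (q.1 : ℤ) - 1 := by rw [Nat.cast_sub hq.1.1]; simp
        have hcalc : ((n + r + 1 + a * b * c j : ℕ) : ℤ) + (V : ℤ) * (((q.1 : ℕ) : ℤ) + (c j : ℤ) * ((q.2 : ℕ) : ℤ) - 1) =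
            ((n + (V * (q.1 - 1) + r + 1) + a * (W * q.2 + b) * c j : ℕ) : ℤ) := by
          push_cast [hq1, hV]
          ring
        rw [hcalc, Int.toNat_natCast]
      rw [Finset.sum_congr rfl heq]
      exact hAg
    calc |∑ r ∈ range V, ∑ q ∈ Icc 1 h ×ˢ Icc 1 h, θ q.2 * sp q.2 (n + (V * (q.1 - 1) + r + 1))|
        ≤ ∑ r ∈ range V, |∑ q ∈ Icc 1 h ×ˢ Icc 1 h, θ q.2 * sp q.2 (n + (V * (q.1 - 1) + r + 1))| :=
          Finset.abs_sum_le_sum_abs _ _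
      _ ≤ ∑ _r ∈ range V, ε₁ * (h : ℝ) ^ 2 := Finset.sum_le_sum hr
      _ = V * (ε₁ * (h : ℝ) ^ 2) := by rw [Finset.sum_const, Finset.card_range, nsmul_eq_mul]
  -- Step 3: assemble
  have hca : ∀ d, corrAvg c x (a * (W * d + b)) * harm x = ∑ n ∈ Icc 1 x, sp d n / n := by
    intro d; simp only [corrAvg, hsp]; field_simp
  have hdecomp : ∀ d, ∑ n ∈ Icc 1 x, sp d n / n =
      (1 / N') * ∑ n' ∈ Icc 1 N', ∑ n ∈ Icc 1 x, sp d (n + n') / n + Rd d := by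
    intro d; simp only [hRd]; ring
  have hPeq : (∑ d ∈ Icc 1 h, θ d * corrAvg c x (a * (W * d + b))) * harm x =
      (1 / N') * ∑ n ∈ Icc 1 x, (1 / (n : ℝ)) * (∑ d ∈ Icc 1 h, ∑ n' ∈ Icc 1 N', θ d * sp d (n + n')) +
        ∑ d ∈ Icc 1 h, θ d * Rd d := by
    rw [Finset.sum_mul]
    have : ∀ d ∈ Icc 1 h, θ d * corrAvg c x (a * (W * d + b)) * harm x =
        θ d * ((1 / N') * ∑ n' ∈ Icc 1 N', ∑ n ∈ Icc 1 x, sp d (n + n') / n) + θ d * Rd d := by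
      intro d _; rw [mul_assoc, hca d, hdecomp d]; ring
    rw [Finset.sum_congr rfl this, Finset.sum_add_distrib]
    congr 1
    simp only [Finset.mul_sum]
    rw [Finset.sum_congr rfl (fun d _ => Finset.sum_comm), Finset.sum_comm]
    exact Finset.sum_congr rfl fun n _ => Finset.sum_congr rfl fun d _ =>
      Finset.sum_congr rfl fun n' _ => by ring
  have hmain : |(1 / N') * ∑ n ∈ Icc 1 x, (1 / (n : ℝ)) * (∑ d ∈ Icc 1 h, ∑ n' ∈ Icc 1 N', θ d * sp d (n + n'))|
      ≤ ε₁ * h * harm x := by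
    rw [abs_mul, abs_of_pos (by positivity : (0 : ℝ) < 1 / N')]
    calc (1 / (N' : ℝ)) * |∑ n ∈ Icc 1 x, (1 / (n : ℝ)) * (∑ d ∈ Icc 1 h, ∑ n' ∈ Icc 1 N', θ d * sp d (n + n'))|
        ≤ (1 / (N' : ℝ)) * ∑ n ∈ Icc 1 x, (1 / (n : ℝ)) * (V * (ε₁ * (h : ℝ) ^ 2)) := by
          apply mul_le_mul_of_nonneg_left _ (by positivity)
          calc |∑ n ∈ Icc 1 x, (1 / (n : ℝ)) * (∑ d ∈ Icc 1 h, ∑ n' ∈ Icc 1 N', θ d * sp d (n + n'))|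
              ≤ ∑ n ∈ Icc 1 x, |(1 / (n : ℝ)) * (∑ d ∈ Icc 1 h, ∑ n' ∈ Icc 1 N', θ d * sp d (n + n'))| :=
                Finset.abs_sum_le_sum_abs _ _
            _ ≤ ∑ n ∈ Icc 1 x, (1 / (n : ℝ)) * (V * (ε₁ * (h : ℝ) ^ 2)) := Finset.sum_le_sum fun n hn => by
                have hn0 : (0 : ℝ) < n := by exact_mod_cast (Finset.mem_Icc.mp hn).1
                rw [abs_mul, abs_of_pos (by positivity : (0 : ℝ) < 1 / n)]
                exact mul_le_mul_of_nonneg_left (hinner n) (by positivity)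
      _ = (1 / (N' : ℝ)) * (V * (ε₁ * (h : ℝ) ^ 2)) * harm x := by
          rw [← Finset.sum_mul, harm]; ring
      _ = ε₁ * h * harm x := by
          simp only [hN']; push_cast
          have hVr : (0 : ℝ) < V := by exact_mod_cast hV1
          have hhr : (0 : ℝ) < h := by exact_mod_cast hh
          field_simp
  have hrem : |∑ d ∈ Icc 1 h, θ d * Rd d| ≤ h * (Bθ * (3 * N')) := by
    calc |∑ d ∈ Icc 1 h, θ d * Rd d| ≤ ∑ d ∈ Icc 1 h, |θ d * Rd d| := Finset.abs_sum_le_sum_abs _ _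
      _ ≤ ∑ _d ∈ Icc 1 h, Bθ * (3 * N') := Finset.sum_le_sum fun d hd => by
          rw [abs_mul]
          exact mul_le_mul (hθb d hd) (hRd_bound d) (abs_nonneg _) hBθ0
      _ = h * (Bθ * (3 * N')) := by rw [Finset.sum_const, Nat.card_Icc, Nat.add_sub_cancel, nsmul_eq_mul]
  have hfinal : |∑ d ∈ Icc 1 h, θ d * corrAvg c x (a * (W * d + b))| * harm x ≤
      (ε₁ * h + 3 * (a * W) * (h : ℝ) ^ 2 * Bθ / harm x) * harm x := by
    calc |∑ d ∈ Icc 1 h, θ d * corrAvg c x (a * (W * d + b))| * harm x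
        = |(∑ d ∈ Icc 1 h, θ d * corrAvg c x (a * (W * d + b))) * harm x| := by
          rw [abs_mul, abs_of_pos hLx]
      _ ≤ ε₁ * h * harm x + h * (Bθ * (3 * N')) := by
          rw [hPeq]
          exact (abs_add_le _ _).trans (add_le_add hmain hrem)
      _ = (ε₁ * h + 3 * (a * W) * (h : ℝ) ^ 2 * Bθ / harm x) * harm x := by
          simp only [hN', hV]; push_cast
          field_simp
  exact le_of_mul_le_mul_right hfinal hLx

/-- The case `G = 1` of the partial sums: `|∑_{d ≤ h} (Λ'_{b,W}(d) - 1)| ≤ ε₁ h` from the bilinear estimate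
with all `gⱼ = 1` (the prime number theorem in progressions modulo `W`, as implied by the uniformity
hypothesis). [cite: TaoTeravainenJTNB2018, §5] -/
theorem abs_sum_theta_le {s : ℕ} (c : Fin (s + 1) → ℕ) {W b h : ℕ} {ε₁ : ℝ}
    (hA : ∀ g : Fin (s + 1) → ℤ → ℝ, (∀ j y, |g j y| ≤ 1) →
      |∑ q ∈ Icc (1 : ℤ) h ×ˢ Icc (1 : ℤ) h,
          (vonMangoldtW W b q.2.toNat - 1) * ∏ j, g j (q.1 + c j * q.2)| ≤ ε₁ * (h : ℝ) ^ 2) :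
    |∑ d ∈ Icc 1 h, (vonMangoldtW W b d - 1)| ≤ ε₁ * h := by
  rcases Nat.eq_zero_or_pos h with hh | hh
  · subst hh; simp
  have hhr : (0 : ℝ) < h := by exact_mod_cast hh
  have h1 := hA (fun _ _ => 1) (fun _ _ => by simp)
  rw [sum_Icc_int_prod_eq_sum_nat, Finset.sum_product] at h1
  simp only [Int.toNat_natCast, Finset.prod_const_one, mul_one] at h1
  rw [Finset.sum_const, Nat.card_Icc, Nat.add_sub_cancel, nsmul_eq_mul, abs_mul, Nat.abs_cast] at h1
  have e1 : (h : ℝ) * |∑ d ∈ Icc 1 h, (vonMangoldtW W b d - 1)| = |∑ d ∈ Icc 1 h, (vonMangoldtW W b d - 1)| * h :=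
    mul_comm _ _
  have e2 : ε₁ * (h : ℝ) ^ 2 = ε₁ * h * h := by ring
  rw [e1, e2] at h1
  exact le_of_mul_le_mul_right h1 hhr

/-- `#{b < W : (W, b) = 1} = φ(W)`. [folklore] -/
theorem card_filter_coprime_range (W : ℕ) :
    ((range W).filter fun b => Nat.Coprime W b).card = Nat.totient W := by
  rw [Nat.totient]

/-- `∑_{p ∈ block} log p / p > 0`. [folklore] -/
theorem primeLogSum_one_pos (m : ℕ) : 0 < primeLogSum m (fun _ => 1) := by
  unfold primeLogSum
  refine Finset.sum_pos (fun p hp => ?_) (primeBlock_nonempty m)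
  have hp := (mem_primeBlock.mp hp).2
  have hp2 : (2 : ℝ) ≤ p := by exact_mod_cast hp.two_le
  have : 0 < Real.log p := Real.log_pos (by linarith)
  positivity

/-- `|∑_p G(p) log p/p| ≤ ∑_p log p/p` for `1`-bounded `G`. [folklore] -/
theorem abs_primeLogSum_le {m : ℕ} {G : ℕ → ℝ} (hG : ∀ n, |G n| ≤ 1) :
    |primeLogSum m G| ≤ primeLogSum m (fun _ => 1) := by
  unfold primeLogSum
  calc |∑ p ∈ primeBlock m, G p * Real.log p / p| ≤ ∑ p ∈ primeBlock m, |G p * Real.log p / p| :=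
        Finset.abs_sum_le_sum_abs _ _
    _ ≤ ∑ p ∈ primeBlock m, 1 * Real.log p / p := Finset.sum_le_sum fun p hp => by
        have hp := (mem_primeBlock.mp hp).2
        have hp2 : (2 : ℝ) ≤ p := by exact_mod_cast hp.two_le
        have hlog : 0 ≤ Real.log p := Real.log_nonneg (by linarith)
        rw [abs_div, abs_mul, Nat.abs_cast, abs_of_nonneg hlog]
        exact div_le_div_of_nonneg_right (mul_le_mul_of_nonneg_right (hG p) hlog) (by positivity)

set_option maxHeartbeats 400000 in
/-- **Tao–Teräväinen 2018, Theorem 3.2 (Comparison)**, CONDITIONAL on Green–Tao's Gowers uniformity estimate at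
level `s` (the number of shifts being `k = s + 1`): for every `ε > 0` there is `w₀` such that for every cutoff
`w ≥ w₀` (`W = ∏_{p ≤ w} p`) and every bound `A` on the dilation parameter there is `M₀`, and for every `M₄` an
`X₀`, with
`|𝔼^{log}_{2^m < p ≤ 2^{m+1}} f_x(ap) - 𝔼^{log}_{2^m < n ≤ 2^{m+1}, (n,W)=1} f_x(an)| ≤ ε`
for all `x ≥ X₀`, `M₀ ≤ m ≤ M₄`, `1 ≤ a ≤ A`, where `f_x(a) = 𝔼^{log}_{n ≤ x} ∏ⱼ λ(n + a cⱼ)`.  (The printed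
"for any natural number `a ≤ H₊` and any `m` with `H₋ ≤ 2^m ≤ H₊` … `x` sufficiently large depending on
`H₊, H₋, w, ε`" is used in §3 only with `a ≤ H₂ < H₃ ≤ 2^m`, i.e. in this shape.)  Proof as in §5:
`(log p)`-weights versus `1/p` on a dyadic block, restriction to `(n, W) = 1`, residue classes modulo `W`,
summation by parts, shift-averaging, and the bilinear estimate `bilinear_vonMangoldtW_le`.
[cite: TaoTeravainenJTNB2018, Theorem 3.2 and §5] -/
theorem comparison {s : ℕ} (hs : 1 ≤ s) {c : Fin (s + 1) → ℕ} (hc : Function.Injective c)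
    (hU : GreenTao2010_gowersUniformityAt s) {ε : ℝ} (hε : 0 < ε) :
    ∃ w₀ : ℕ, ∀ w : ℕ, w₀ ≤ w → ∀ A : ℕ, ∃ M₀ : ℕ, ∀ M₄ : ℕ, ∃ X₀ : ℕ, ∀ x : ℕ, X₀ ≤ x →
      ∀ m : ℕ, M₀ ≤ m → m ≤ M₄ → ∀ a : ℕ, 1 ≤ a → a ≤ A →
        |primeLogAvg m (fun q => corrAvg c x (a * q)) -
          roughLogAvg (primorial w) m (fun n => corrAvg c x (a * n))| ≤ ε := by
  -- the bilinear estimate with `ε₁ = ε/256`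
  obtain ⟨ε₁, hε₁def⟩ : ∃ ε₁ : ℝ, ε₁ = ε / 256 := ⟨_, rfl⟩
  have hε₁ : 0 < ε₁ := by rw [hε₁def]; positivity
  obtain ⟨w₀, H₀, hA⟩ := bilinear_vonMangoldtW_le hs hc hU hε₁
  refine ⟨max w₀ 2, fun w hw A => ?_⟩
  have hw₀ : w₀ ≤ w := le_of_max_le_left hw
  have hw2 : 2 ≤ w := le_of_max_le_right hw
  obtain ⟨W, hWdef⟩ : ∃ W : ℕ, W = primorial w := ⟨_, rfl⟩
  have hW2 : 2 ≤ W := by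
    rw [hWdef]
    calc 2 = primorial 2 := primorial_two.symm
      _ ≤ primorial w := primorial_mono hw2
  have hW1 : 1 ≤ W := by omega
  have hWr : (0 : ℝ) < W := by exact_mod_cast hW1
  -- threshold for `m`
  obtain ⟨E, hE⟩ : ∃ E : ℝ, E = Real.exp (Real.exp (2 * w)) + 2 := ⟨_, rfl⟩
  have hE0 : 0 ≤ E := by rw [hE]; positivity
  obtain ⟨M₀, hM₀⟩ : ∃ M₀ : ℕ, M₀ = ⌈(W : ℝ) * E⌉₊ + W * (H₀ + 2) + 4 * W + w + 2 + ⌈16 / ε⌉₊ := ⟨_, rfl⟩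
  refine ⟨M₀, fun M₄ => ?_⟩
  -- threshold for `x`
  obtain ⟨hmax, hhmax⟩ : ∃ hmax : ℕ, hmax = 2 ^ (M₄ + 1) := ⟨_, rfl⟩
  obtain ⟨Kx, hKx⟩ : ∃ Kx : ℝ, Kx = 3 * A * W * hmax * (1 + Real.log ((W * hmax + W : ℕ) : ℝ)) / ε₁ := ⟨_, rfl⟩
  obtain ⟨X₀, hX₀⟩ : ∃ X₀ : ℕ, X₀ = ⌈Real.exp Kx⌉₊ + 1 := ⟨_, rfl⟩
  refine ⟨X₀, ?_⟩
  intro x hx m hm hmM₄ a ha1 haA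
  rw [← hWdef]
  -- consequences of `m ≥ M₀`
  have hm2m : m < 2 ^ m := Nat.lt_two_pow_self
  have hmM₀ : ⌈(W : ℝ) * E⌉₊ + W * (H₀ + 2) + 4 * W + w + 2 + ⌈16 / ε⌉₊ ≤ m := by rw [← hM₀]; exact hm
  have hc1 : (W : ℝ) * E ≤ 2 ^ m := by
    have h1 : (W : ℝ) * E ≤ ⌈(W : ℝ) * E⌉₊ := Nat.le_ceil _
    have h2 : (⌈(W : ℝ) * E⌉₊ : ℝ) ≤ m := by exact_mod_cast (by omega : ⌈(W : ℝ) * E⌉₊ ≤ m)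
    have h3 : (m : ℝ) ≤ 2 ^ m := by exact_mod_cast hm2m.le
    linarith
  have hc2 : W * (H₀ + 2) ≤ 2 ^ m := by omega
  have hc3 : 4 * W ≤ 2 ^ m := by omega
  have hc4 : w ≤ 2 ^ m := by omega
  have hc5 : 2 ≤ m := by omega
  have hc6 : 16 / ε ≤ m := by
    have h1 : 16 / ε ≤ ⌈16 / ε⌉₊ := Nat.le_ceil _
    have h2 : (⌈16 / ε⌉₊ : ℝ) ≤ m := by exact_mod_cast (by omega : ⌈16 / ε⌉₊ ≤ m)
    linarith
  have hWm : W ≤ 2 ^ m := by omega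
  have h2m : (0 : ℝ) < 2 ^ m := by positivity
  -- consequences of `x ≥ X₀`
  have hx1 : 1 ≤ x := by omega
  have hLx : Kx ≤ harm x := by
    have h1 : Real.exp Kx ≤ X₀ := by
      rw [hX₀]; push_cast; linarith [Nat.le_ceil (Real.exp Kx)]
    have h2 : Kx ≤ Real.log x := by
      rw [← Real.log_exp Kx]
      exact Real.log_le_log (Real.exp_pos _) (h1.trans (by exact_mod_cast hx))
    exact h2.trans (log_le_harm x)
  -- drop the thresholds (their casts slow down `linarith`/`omega`)
  clear hmM₀ hM₀ hm hX₀ hx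
  -- the function `G = f_x(a ·)`
  obtain ⟨G, hGdef⟩ : ∃ G : ℕ → ℝ, G = fun n => corrAvg c x (a * n) := ⟨_, rfl⟩
  have hG1 : ∀ n, |G n| ≤ 1 := fun n => by rw [hGdef]; exact abs_corrAvg_le_one c x _
  rw [show (fun q => corrAvg c x (a * q)) = G from hGdef.symm]
  -- (i) `1/p` versus `(log p)/p`
  have hstep1 : |primeLogAvg m G - primeLogSum m G / primeLogSum m (fun _ => 1)| ≤ ε / 4 := by
    have h := abs_primeLogAvg_sub_ratio_le hc5 hG1
    have hm0 : (0 : ℝ) < m := by exact_mod_cast (by omega : 0 < m)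
    have : (4 : ℝ) / m ≤ ε / 4 := by
      rw [div_le_div_iff₀ hm0 (by norm_num)]
      have := (div_le_iff₀ hε).mp hc6
      linarith
    exact h.trans this
  -- (ii) the residue sums are small
  have hres : ∀ (G' : ℕ → ℝ), (∀ b h, 1 ≤ b → b < W → Nat.Coprime W b → (2 ^ m - b) / W ≤ h → h ≤ (2 ^ (m + 1) - b) / W →
        |∑ d ∈ Icc 1 h, (vonMangoldtW W b d - 1) * G' (W * d + b)| ≤ 2 * ε₁ * h) →
      ∀ b, 1 ≤ b → b < W → Nat.Coprime W b → |residueSum W b m G'| ≤ 8 * ε₁ / W := by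
    intro G' hP b hb1 hbW hbcop
    obtain ⟨dlo, hdlo⟩ : ∃ dlo : ℕ, dlo = (2 ^ m - b) / W := ⟨_, rfl⟩
    obtain ⟨dhi, hdhi⟩ : ∃ dhi : ℕ, dhi = (2 ^ (m + 1) - b) / W := ⟨_, rfl⟩
    have hbm : b ≤ 2 ^ m := by omega
    have hlohi : dlo < dhi := by
      rw [hdlo, hdhi, Nat.div_lt_iff_lt_mul hW1]
      have : (2 ^ (m + 1) - b) / W * W + W > 2 ^ (m + 1) - b := by
        have := Nat.lt_div_mul_add hW1 (a := 2 ^ (m + 1) - b); linarith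
      have h2 : 2 ^ (m + 1) = 2 * 2 ^ m := by ring
      omega
    have hdhir : (dhi : ℝ) ≤ 2 ^ (m + 1) / W := by
      rw [le_div_iff₀ hWr]
      have : dhi * W ≤ 2 ^ (m + 1) - b := by rw [hdhi]; exact Nat.div_mul_le_self _ _
      have : dhi * W ≤ 2 ^ (m + 1) := this.trans (Nat.sub_le _ _)
      exact_mod_cast this
    have hdhi0 : (0 : ℝ) ≤ dhi := by positivity
    have hab := abel_bound (g := fun d => (vonMangoldtW W b d - 1) * G' (W * d + b))
      (ω := fun d => 1 / ((W * d + b : ℕ) : ℝ)) hlohi (P := 2 * ε₁ * dhi)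
      (fun d _ _ => by positivity)
      (fun d _ _ => by
        apply one_div_le_one_div_of_le
        · exact_mod_cast (by omega : 0 < W * d + b)
        · exact_mod_cast (by nlinarith : W * d + b ≤ W * (d + 1) + b))
      (fun h hlo hhi => (hP b h hb1 hbW hbcop (hdlo ▸ hlo) (hdhi ▸ hhi)).trans (by
        have : (h : ℝ) ≤ dhi := by exact_mod_cast hhi
        nlinarith))
    have hωlo : 1 / ((W * (dlo + 1) + b : ℕ) : ℝ) ≤ 1 / 2 ^ m := by
      have hmem : dlo + 1 ∈ dRange W b m := by
        rw [dRange, ← hdlo, ← hdhi]; exact Finset.mem_Ioc.mpr ⟨Nat.lt_succ_self _, hlohi⟩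
      have h1 := ((mem_dRange_iff hW1 hbm).mp hmem).1
      apply one_div_le_one_div_of_le h2m
      exact_mod_cast h1.le
    calc |residueSum W b m G'| = |∑ d ∈ Ioc dlo dhi, (vonMangoldtW W b d - 1) * G' (W * d + b) * (1 / ((W * d + b : ℕ) : ℝ))| := by
          rw [residueSum, dRange, ← hdlo, ← hdhi]
          congr 1
          exact Finset.sum_congr rfl fun d _ => by ring
      _ ≤ 2 * (2 * ε₁ * dhi) * (1 / ((W * (dlo + 1) + b : ℕ) : ℝ)) := hab
      _ ≤ 2 * (2 * ε₁ * dhi) * (1 / 2 ^ m) := mul_le_mul_of_nonneg_left hωlo (by positivity)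
      _ ≤ 2 * (2 * ε₁ * (2 ^ (m + 1) / W)) * (1 / 2 ^ m) := by gcongr
      _ = 8 * ε₁ / W := by rw [pow_succ]; field_simp; ring
  -- the hypotheses of (ii) for `G` and for `1`, from the bilinear estimate at scale `h`
  have hscale : ∀ b h, 1 ≤ b → b < W → (2 ^ m - b) / W ≤ h →
      (H₀ ≤ h) ∧ ((w : ℝ) ≤ Real.log (Real.log h) / 2) := by
    intro b h hb1 hbW hlo
    -- `h ≥ (2^m - W)/W ≥ 2^m/W - 1`
    have hh1 : 2 ^ m / W ≤ h + 1 := by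
      have : (2 ^ m - b) / W + 1 ≥ 2 ^ m / W := by
        have h1 : 2 ^ m ≤ (2 ^ m - b) + W := by omega
        calc 2 ^ m / W ≤ ((2 ^ m - b) + W) / W := Nat.div_le_div_right h1
          _ = (2 ^ m - b) / W + 1 := by rw [Nat.add_div_right _ hW1]
      omega
    constructor
    · -- `H₀ + 2 ≤ 2^m / W`
      have : H₀ + 2 ≤ 2 ^ m / W := (Nat.le_div_iff_mul_le hW1).mpr (by linarith [hc2, mul_comm W (H₀ + 2)])
      omega
    · have hhr : Real.exp (Real.exp (2 * w)) ≤ h := by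
        have h1 : (W : ℝ) * E ≤ 2 ^ m := hc1
        have h2 : ((2 ^ m / W : ℕ) : ℝ) ≤ h + 1 := by exact_mod_cast hh1
        have h3 : (2 : ℝ) ^ m / W - 1 ≤ ((2 ^ m / W : ℕ) : ℝ) := by
          have := Nat.lt_div_mul_add hW1 (a := 2 ^ m)
          have h4 : ((2 ^ m : ℕ) : ℝ) < (2 ^ m / W : ℕ) * W + W := by exact_mod_cast this
          push_cast at h4
          rw [sub_le_iff_le_add, div_le_iff₀ hWr]; linarith
        have h5 : E ≤ (2 : ℝ) ^ m / W := by rw [le_div_iff₀ hWr]; linarith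
        rw [hE] at h5
        linarith
      have hh0 : (0 : ℝ) < h := lt_of_lt_of_le (by positivity) hhr
      have hlog1 : Real.exp (2 * w) ≤ Real.log h := by
        rw [← Real.log_exp (Real.exp (2 * w))]; exact Real.log_le_log (Real.exp_pos _) hhr
      have hlog2 : 2 * (w : ℝ) ≤ Real.log (Real.log h) := by
        rw [← Real.log_exp (2 * w)]; exact Real.log_le_log (Real.exp_pos _) hlog1
      linarith
  have hAh : ∀ b h, 1 ≤ b → b < W → Nat.Coprime W b → (2 ^ m - b) / W ≤ h →
      ∀ g : Fin (s + 1) → ℤ → ℝ, (∀ j y, |g j y| ≤ 1) →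
        |∑ q ∈ Icc (1 : ℤ) h ×ˢ Icc (1 : ℤ) h,
            (vonMangoldtW W b q.2.toNat - 1) * ∏ j, g j (q.1 + c j * q.2)| ≤ ε₁ * (h : ℝ) ^ 2 := by
    intro b h hb1 hbW hbcop hlo g hg
    obtain ⟨hH₀, hwh⟩ := hscale b h hb1 hbW hlo
    have := hA h hH₀ w hw₀ hwh b hb1 (by rw [← hWdef]; exact hbW.le) (by rw [← hWdef]; exact hbcop.symm) g hg
    rwa [← hWdef] at this
  have hPG : ∀ b h, 1 ≤ b → b < W → Nat.Coprime W b → (2 ^ m - b) / W ≤ h → h ≤ (2 ^ (m + 1) - b) / W →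
      |∑ d ∈ Icc 1 h, (vonMangoldtW W b d - 1) * G (W * d + b)| ≤ 2 * ε₁ * h := by
    intro b h hb1 hbW hbcop hlo hhi
    have hL4 : |∑ d ∈ Icc 1 h, (vonMangoldtW W b d - 1) * G (W * d + b)| ≤
        ε₁ * h + 3 * (a * W) * (h : ℝ) ^ 2 * (1 + Real.log ((W * h + b : ℕ) : ℝ)) / harm x := by
      rw [hGdef]; exact abs_partialSum_le c hW1 hb1 ha1 hx1 (hAh b h hb1 hbW hbcop hlo)
    have hhr0 : (0 : ℝ) ≤ h := by positivity
    -- the remainder is at most `ε₁ h` since `harm x ≥ Kx`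
    have hrem : 3 * (a * W) * (h : ℝ) ^ 2 * (1 + Real.log ((W * h + b : ℕ) : ℝ)) / harm x ≤ ε₁ * h := by
      rcases Nat.eq_zero_or_pos h with hh | hh
      · subst hh; simp
      have hhr : (0 : ℝ) < h := by exact_mod_cast hh
      have hLx0 : 0 < harm x := harm_pos hx1
      rw [div_le_iff₀ hLx0]
      -- `3 a W h² B ≤ ε₁ h · Kx ≤ ε₁ h · harm x`
      have hhle : h ≤ hmax := by
        have h1 : h ≤ 2 ^ (m + 1) :=
          hhi.trans ((Nat.div_le_self _ _).trans (Nat.sub_le _ _))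
        rw [hhmax]
        exact h1.trans (Nat.pow_le_pow_right (by norm_num) (by omega))
      have hWhb1 : 1 ≤ W * h + b := le_add_left hb1
      have hWhbr : (1 : ℝ) ≤ ((W * h + b : ℕ) : ℝ) := by exact_mod_cast hWhb1
      have hB : 1 + Real.log ((W * h + b : ℕ) : ℝ) ≤ 1 + Real.log ((W * hmax + W : ℕ) : ℝ) := by
        have hle : W * h + b ≤ W * hmax + W := Nat.add_le_add (Nat.mul_le_mul_left W hhle) hbW.le
        have hler : ((W * h + b : ℕ) : ℝ) ≤ ((W * hmax + W : ℕ) : ℝ) := by exact_mod_cast hle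
        have := Real.log_le_log (by linarith) hler
        linarith
      have hB0 : 0 ≤ 1 + Real.log ((W * h + b : ℕ) : ℝ) := by
        have := Real.log_nonneg hWhbr
        linarith
      have har : (a : ℝ) ≤ A := by exact_mod_cast haA
      have hhr' : (h : ℝ) ≤ hmax := by exact_mod_cast hhle
      have hKx' : 3 * (a : ℝ) * W * h * (1 + Real.log ((W * h + b : ℕ) : ℝ)) ≤ ε₁ * Kx := by
        rw [hKx]
        have : ε₁ * (3 * A * W * hmax * (1 + Real.log ((W * hmax + W : ℕ) : ℝ)) / ε₁) =
            3 * A * W * hmax * (1 + Real.log ((W * hmax + W : ℕ) : ℝ)) := by field_simp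
        rw [this]
        have h1 : 3 * (a : ℝ) * W * h * (1 + Real.log ((W * h + b : ℕ) : ℝ)) ≤
            3 * A * W * h * (1 + Real.log ((W * h + b : ℕ) : ℝ)) := by gcongr
        have h2 : 3 * (A : ℝ) * W * h * (1 + Real.log ((W * h + b : ℕ) : ℝ)) ≤
            3 * A * W * hmax * (1 + Real.log ((W * h + b : ℕ) : ℝ)) := by gcongr
        have h3 : 3 * (A : ℝ) * W * hmax * (1 + Real.log ((W * h + b : ℕ) : ℝ)) ≤
            3 * A * W * hmax * (1 + Real.log ((W * hmax + W : ℕ) : ℝ)) := by gcongr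
        linarith
      calc 3 * ((a : ℝ) * W) * (h : ℝ) ^ 2 * (1 + Real.log ((W * h + b : ℕ) : ℝ))
          = h * (3 * (a : ℝ) * W * h * (1 + Real.log ((W * h + b : ℕ) : ℝ))) := by ring
        _ ≤ h * (ε₁ * Kx) := mul_le_mul_of_nonneg_left hKx' hhr.le
        _ ≤ h * (ε₁ * harm x) := mul_le_mul_of_nonneg_left (mul_le_mul_of_nonneg_left hLx hε₁.le) hhr.le
        _ = ε₁ * h * harm x := by ring
    linarith
  have hP1 : ∀ b h, 1 ≤ b → b < W → Nat.Coprime W b → (2 ^ m - b) / W ≤ h → h ≤ (2 ^ (m + 1) - b) / W →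
      |∑ d ∈ Icc 1 h, (vonMangoldtW W b d - 1) * (fun _ => (1 : ℝ)) (W * d + b)| ≤ 2 * ε₁ * h := by
    intro b h hb1 hbW hbcop hlo _
    have := abs_sum_theta_le c (hAh b h hb1 hbW hbcop hlo)
    simp only [mul_one]
    have hhr0 : (0 : ℝ) ≤ h := by positivity
    have := mul_nonneg hε₁.le hhr0
    linarith
  -- (iii) sum over the reduced residues: `|e(G)| ≤ 8 ε₁ φ(W)/W`
  have hsumres : ∀ (G' : ℕ → ℝ), (∀ b, 1 ≤ b → b < W → Nat.Coprime W b → |residueSum W b m G'| ≤ 8 * ε₁ / W) →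
      |roughSum W m G' - (Nat.totient W : ℝ) / W * primeLogSum m G'| ≤ 8 * ε₁ * Nat.totient W / W := by
    intro G' hb
    have hE1 := sum_residueSum_eq (w := w) (hWdef ▸ hW1) (hWdef ▸ hWm) hc4 G'
    rw [← hWdef] at hE1
    rw [abs_sub_comm, ← hE1]
    calc |∑ b ∈ (range W).filter (fun b => Nat.Coprime W b), residueSum W b m G'|
        ≤ ∑ b ∈ (range W).filter (fun b => Nat.Coprime W b), |residueSum W b m G'| := Finset.abs_sum_le_sum_abs _ _
      _ ≤ ∑ _b ∈ (range W).filter (fun b => Nat.Coprime W b), 8 * ε₁ / W := Finset.sum_le_sum fun b hb' => by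
          rw [Finset.mem_filter, Finset.mem_range] at hb'
          have hb1 : 1 ≤ b := by
            rcases Nat.eq_zero_or_pos b with h0 | h0
            · exfalso; rw [h0] at hb'; have := hb'.2; rw [Nat.coprime_zero_right] at this; omega
            · exact h0
          exact hb b hb1 hb'.1 hb'.2
      _ = 8 * ε₁ * Nat.totient W / W := by
          rw [Finset.sum_const, card_filter_coprime_range, nsmul_eq_mul]; ring
  have heG := hsumres G (hres G hPG)
  have he1 := hsumres (fun _ => 1) (hres (fun _ => 1) hP1)
  -- (iv) denominators
  have hS1 : (Nat.totient W : ℝ) / (4 * W) ≤ roughSum W m (fun _ => 1) := by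
    have := roughBlock_sum_inv_ge hW1 hc3
    rw [roughSum]; exact this
  have hφ0 : (0 : ℝ) < Nat.totient W := by exact_mod_cast Nat.totient_pos.mpr (by omega)
  have hS1pos : 0 < roughSum W m (fun _ => 1) := lt_of_lt_of_le (by positivity) hS1
  have hpls1 := primeLogSum_one_pos m
  have hB'pos : 0 < (Nat.totient W : ℝ) / W * primeLogSum m (fun _ => 1) := by positivity
  have hstep2 : |roughLogAvg W m G - primeLogSum m G / primeLogSum m (fun _ => 1)| ≤ ε / 4 := by
    have hQ : primeLogSum m G / primeLogSum m (fun _ => 1) =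
        ((Nat.totient W : ℝ) / W * primeLogSum m G) / ((Nat.totient W : ℝ) / W * primeLogSum m (fun _ => 1)) := by
      rw [mul_div_mul_left _ _ (by positivity : (Nat.totient W : ℝ) / W ≠ 0)]
    have hRHS : roughLogAvg W m G = roughSum W m G / roughSum W m (fun _ => 1) := by
      rw [roughLogAvg, roughSum, roughSum]
    rw [hQ, hRHS]
    have hA' : |(Nat.totient W : ℝ) / W * primeLogSum m G| ≤ (Nat.totient W : ℝ) / W * primeLogSum m (fun _ => 1) := by
      rw [abs_mul, abs_of_pos (by positivity : (0 : ℝ) < (Nat.totient W : ℝ) / W)]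
      exact mul_le_mul_of_nonneg_left (abs_primeLogSum_le hG1) (by positivity)
    have h := abs_div_sub_div_le (A := roughSum W m G) hS1pos hB'pos hA'
    refine h.trans ?_
    rw [div_le_iff₀ hS1pos]
    calc |roughSum W m G - (Nat.totient W : ℝ) / W * primeLogSum m G| +
          |roughSum W m (fun _ => 1) - (Nat.totient W : ℝ) / W * primeLogSum m (fun _ => 1)|
        ≤ 8 * ε₁ * Nat.totient W / W + 8 * ε₁ * Nat.totient W / W := add_le_add heG he1
      _ = ε / 4 * ((Nat.totient W : ℝ) / (4 * W)) := by rw [hε₁def]; ring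
      _ ≤ ε / 4 * roughSum W m (fun _ => 1) := mul_le_mul_of_nonneg_left hS1 (by linarith)
  -- (v) conclusion
  calc |primeLogAvg m G - roughLogAvg W m G|
      ≤ |primeLogAvg m G - primeLogSum m G / primeLogSum m (fun _ => 1)| +
          |primeLogSum m G / primeLogSum m (fun _ => 1) - roughLogAvg W m G| := abs_sub_le _ _ _
    _ ≤ ε / 4 + ε / 4 := add_le_add hstep1 (by rw [abs_sub_comm]; exact hstep2)
    _ ≤ ε := by linarith

end TaoTeravainen2018

end Literature.NumberTheory.Sieve
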